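import Summits.CriticalPhenomena.PercolationContinuityZ3.Theorems.PercNearOneGluingNoHeavyLowerTailSahiE3MajCertA
import Summits.CriticalPhenomena.PercolationContinuityZ3.Theorems.PercNearOneGluingNoHeavyLowerTailSahiE3MajCertAp
import Mathlib.Data.Real.Basic
import Mathlib.Tactic.Linarith
import Mathlib.Tactic.Positivity
import Mathlib.Tactic.FieldSimp
import HarnessLib
import HarnessLib.Audit

/-!
# `NoHeavyLowerTail` (crux stmt-CriticalPhenomena-4575), Sahi programme P4 (Holley / monotone coupling):
# the maj-slot certificate on the pattern `2³` — VI: regimes A and A'(k) as existence statements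

Support file (cell `prim-l12`, seat P4, generation 9; `--supports stmt-CriticalPhenomena-4575`).  No named facts, no
sorries; standard axioms; pure real algebra.  The proofs are machine-found certificates: every item is closed by `linarith` from an
explicit nonnegative combination of the listed facts (an exact rational Positivstellensatz-type certificate found by linear
programming over products of the facts with nonnegative aggregate masses, verified in exact arithmetic before emission; generator
and certificates in HOME prim-l12-p4/code/gen9, memo FROM-prim-l12-p4-gen9-MAJ-SLOT-LEAN.md).

Setting (memo HOME prim-l12-p4/FROM-prim-l12-p4-gen8-PATTERN-CERTIFICATES.md §4b): the pattern `2³` of three join-primes with the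
majority slot `MAJ = {ij, ik, jk, ⊤}`; for a labelling `(i, j, k)` of the atoms the eight fibre masses are `nE, ni, nj, nk, nij,
nik, njk, nT` with total `Z` (kept as a symbol; `d = nE+ni+nj+nk`, `u = nij+nik+njk+nT`, NOT normalised); the hypotheses are
consequences of log-supermodularity of the pattern measure (`…SahiE3MajPatternFacts.facts_of_pattern`); the conclusions are the
validity / up-transport / pair inequalities for retained masses `rij, rik, rjk, rT` (homogeneous of degree three) consumed by
`…SahiE3MajPattern.certificate_of_ineqs`.  Regimes: A (top full, uniform rank-2 fill), A'(k) (top full, Hall(k) tight), B1 (top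
only), B2(k) (donors of k drained) — HOME memo §4b; the case analysis is `…SahiE3MajCore.exists_cert`.
-/

namespace Summit.CriticalPhenomena.PercolationContinuityZ3.Theorems.SahiE3MajCert

/-- **Regime A** (top full, uniform rank-2 fill: `r_xy = Z·n_xy·(Z − δ)`, `δ·N₂ = d·n_⊤`, `r_⊤ = Z(Z+d)n_⊤`), valid
        when `d·n_⊤ ≤ Z·N₂` and the three single-atom Hall inequalities `n_x·n_yz ≤ (d − n_x)·σ_x` hold.
        [this work] -/
theorem cert_A (nE ni nj nk nij nik njk nT Z : ℝ)
    (h_nn_E : 0 ≤ nE) (h_nn_0 : 0 ≤ ni) (h_nn_1 : 0 ≤ nj) (h_nn_2 : 0 ≤ nk) (h_nn_01 : 0 ≤ nij) (h_nn_02 : 0 ≤ nik)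
    (h_nn_12 : 0 ≤ njk) (h_nn_T : 0 ≤ nT) (h_nn_Z : 0 ≤ Z) (h_sum : Z = nE + ni + nj + nk + nij + nik + njk + nT)
    (h_fkg_aa01 : (ni + nij + nik + nT) * (nj + nij + njk + nT) ≤ Z * (nij + nT))
    (h_fkg_aa02 : (ni + nij + nik + nT) * (nk + nik + njk + nT) ≤ Z * (nik + nT))
    (h_fkg_aa12 : (nj + nij + njk + nT) * (nk + nik + njk + nT) ≤ Z * (njk + nT))
    (h_fkg_AA0 : (nij + nT) * (nik + nT) ≤ Z * nT) (h_fkg_AA1 : (nij + nT) * (njk + nT) ≤ Z * nT)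
    (h_fkg_AA2 : (nik + nT) * (njk + nT) ≤ Z * nT) (h_fkg_Aa01 : (nij + nT) * (nk + nik + njk + nT) ≤ Z * nT)
    (h_fkg_Aa02 : (nik + nT) * (nj + nij + njk + nT) ≤ Z * nT)
    (h_fkg_Aa12 : (njk + nT) * (ni + nij + nik + nT) ≤ Z * nT)
    (hallA_i : ni * njk ≤ ((nE + ni + nj + nk) - ni) * (nij + nik))
    (hallA_j : nj * nik ≤ ((nE + ni + nj + nk) - nj) * (nij + njk))
    (hallA_k : nk * nij ≤ ((nE + ni + nj + nk) - nk) * (nik + njk))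
    (hN2le : (nE + ni + nj + nk) * nT ≤ Z * (nij + nik + njk)) (hN2pos : 0 < nij + nik + njk) :
    ∃ rij rik rjk rT : ℝ,
      0 ≤ rij ∧
      0 ≤ rik ∧
      0 ≤ rjk ∧
      0 ≤ rT ∧
      rij ≤ Z * (Z + (nE + ni + nj + nk)) * nij ∧
              rik ≤ Z * (Z + (nE + ni + nj + nk)) * nik ∧
      rjk ≤ Z * (Z + (nE + ni + nj + nk)) * njk ∧
              rT ≤ Z * (Z + (nE + ni + nj + nk)) * nT ∧
      Z * (nij + nik + njk + nT) * ni ≤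
              (Z * (Z + (nE + ni + nj + nk)) * nij - rij) + (Z * (Z + (nE + ni + nj + nk)) * nik - rik) +
              (Z * (Z + (nE + ni + nj + nk)) * nT - rT) ∧
      Z * (nij + nik + njk + nT) * nj ≤
              (Z * (Z + (nE + ni + nj + nk)) * nij - rij) + (Z * (Z + (nE + ni + nj + nk)) * njk - rjk) +
              (Z * (Z + (nE + ni + nj + nk)) * nT - rT) ∧
      Z * (nij + nik + njk + nT) * nk ≤
              (Z * (Z + (nE + ni + nj + nk)) * nik - rik) + (Z * (Z + (nE + ni + nj + nk)) * njk - rjk) +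
              (Z * (Z + (nE + ni + nj + nk)) * nT - rT) ∧
      rij + rik + rjk + rT = Z * Z *
              (nij + nik + njk + nT) ∧
      Z * Z * nT ≤ rT ∧
      Z * Z * (nij + nT) ≤ rij + rT ∧
      Z * Z *
              (nik + nT) ≤ rik + rT ∧
      Z * Z * (njk + nT) ≤ rjk + rT ∧
      Z * Z * (nij + nik + nT) ≤ rij +
              rik + rT ∧
      Z * Z * (nij + njk + nT) ≤ rij + rjk + rT ∧
      Z * Z * (nik + njk + nT) ≤ rik +
              rjk + rT ∧
      Z * ((nij + nT) * (nik + nT) + (nik + nT) * (nij + nT)) - (nij + nik + njk + nT) *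
              (nij + nT) * (nik + nT) ≤ rT ∧
      Z * ((nij + nT) * (njk + nT) + (njk + nT) * (nij + nT)) -
              (nij + nik + njk + nT) * (nij + nT) * (njk + nT) ≤ rT ∧
      Z *
              ((nik + nT) * (njk + nT) + (njk + nT) * (nik + nT)) - (nij + nik + njk + nT) * (nik + nT) *
              (njk + nT) ≤ rT ∧
      Z * ((nij + nT) * (nik + njk + nT) + (nk + nik + njk + nT) * (nij + nT)) -
              (nij + nik + njk + nT) * (nij + nT) * (nk + nik + njk + nT) ≤ rT ∧
      Z *
              ((nik + nT) * (nij + njk + nT) + (nj + nij + njk + nT) * (nik + nT)) - (nij + nik + njk + nT) *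
              (nik + nT) * (nj + nij + njk + nT) ≤ rT ∧
      Z *
              ((njk + nT) * (nij + nik + nT) + (ni + nij + nik + nT) * (njk + nT)) - (nij + nik + njk + nT) *
              (njk + nT) * (ni + nij + nik + nT) ≤ rT ∧
      Z *
              ((ni + nij + nik + nT) * (nij + nik + nT) + (ni + nij + nik + nT) * (nij + nik + nT)) -
              (nij + nik + njk + nT) * (ni + nij + nik + nT) * (ni + nij + nik + nT) ≤ rij + rik + rT ∧
      Z *
              ((nj + nij + njk + nT) * (nij + njk + nT) + (nj + nij + njk + nT) * (nij + njk + nT)) -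
              (nij + nik + njk + nT) * (nj + nij + njk + nT) * (nj + nij + njk + nT) ≤ rij + rjk + rT ∧
      Z *
              ((nk + nik + njk + nT) * (nik + njk + nT) + (nk + nik + njk + nT) * (nik + njk + nT)) -
              (nij + nik + njk + nT) * (nk + nik + njk + nT) * (nk + nik + njk + nT) ≤ rik + rjk + rT ∧
      Z *
              ((ni + nij + nik + nT) * (nij + njk + nT) + (nj + nij + njk + nT) * (nij + nik + nT)) -
              (nij + nik + njk + nT) * (ni + nij + nik + nT) * (nj + nij + njk + nT) ≤ rij + rT ∧
      Z *
              ((ni + nij + nik + nT) * (nik + njk + nT) + (nk + nik + njk + nT) * (nij + nik + nT)) -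
              (nij + nik + njk + nT) * (ni + nij + nik + nT) * (nk + nik + njk + nT) ≤ rik + rT ∧
      Z *
              ((nj + nij + njk + nT) * (nik + njk + nT) + (nk + nik + njk + nT) * (nij + njk + nT)) -
              (nij + nik + njk + nT) * (nj + nij + njk + nT) * (nk + nik + njk + nT) ≤ rjk + rT := by
  obtain ⟨dl, hdl, hdl0, hdl1⟩ : ∃ dl : ℝ, dl * (nij + nik + njk) = (nE + ni + nj + nk) * nT ∧ 0 ≤ dl ∧
      dl ≤ Z :=
    ⟨(nE + ni + nj + nk) * nT / (nij + nik + njk), div_mul_cancel₀ _ hN2pos.ne', div_nonneg (by positivity)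
            hN2pos.le,
      (div_le_iff₀ hN2pos).2 hN2le⟩
  obtain ⟨v1, v2, v3, v4, v5, v6, v7, v8, v9, v10, v11, v12, v13, v14, v15, v16, v17, v18, v19⟩ :=
    cert_A_valid
          nE ni nj nk nij nik njk nT Z h_nn_E h_nn_0 h_nn_1 h_nn_2 h_nn_01 h_nn_02 h_nn_12 h_nn_T h_nn_Z hallA_i
          hallA_j hallA_k hN2pos dl hdl hdl0 hdl1
  obtain ⟨w1, w2, w3, w4, w5, w6⟩ :=
    cert_A_pairs nE ni nj nk nij nik njk nT Z h_nn_E h_nn_0 h_nn_1 h_nn_2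
          h_nn_01 h_nn_02 h_nn_12 h_nn_T h_nn_Z h_sum h_fkg_AA0 h_fkg_AA1 h_fkg_AA2 h_fkg_Aa01 h_fkg_Aa02
          h_fkg_Aa12  
  obtain ⟨x1, x2, x3, x4, x5, x6⟩ :=
    cert_A_pairsR nE ni nj nk nij nik njk nT Z h_nn_E h_nn_0 h_nn_1 h_nn_2
          h_nn_01 h_nn_02 h_nn_12 h_nn_T h_nn_Z h_sum h_fkg_aa01 h_fkg_aa02 h_fkg_aa12 h_fkg_Aa01 h_fkg_Aa02
          hN2pos dl hdl hdl0
  exact ⟨(Z*nij*(Z - dl)), (Z*nik*(Z - dl)), (Z*njk*(Z - dl)), (Z*(Z + (nE + ni + nj + nk))*nT),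
    v1, v2, v3,
          v4, v5, v6, v7, v8, v9, v10, v11, v12, v13, v14, v15, v16, v17, v18, v19, w1, w2, w3, w4, w5, w6, x1, x2,
          x3, x4, x5, x6⟩

/-- **Regime A'(k)** (top full, Hall(k) tight: `r_ij = Z·u·(Z + n_k) − Z(Z+d)·B_k`, `r_xk = Z(Z + d − θ)n_xk` with
        `θ·σ_k = u·n_k`), valid when `(d − n_k)σ_k ≤ n_k n_ij`, `d·n_⊤ ≤ Z·N₂`, `u·n_k ≤ (Z+d)σ_k`, `σ_k > 0`.
        [this work] -/
theorem cert_Ap (nE ni nj nk nij nik njk nT Z : ℝ)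
    (h_nn_E : 0 ≤ nE) (h_nn_0 : 0 ≤ ni) (h_nn_1 : 0 ≤ nj) (h_nn_2 : 0 ≤ nk) (h_nn_01 : 0 ≤ nij) (h_nn_02 : 0 ≤ nik)
    (h_nn_12 : 0 ≤ njk) (h_nn_T : 0 ≤ nT) (h_nn_Z : 0 ≤ Z) (h_sum : Z = nE + ni + nj + nk + nij + nik + njk + nT)
    (h_lsm_r2 : nik * njk ≤ nk * nT) (h_fkg_aa02 : (ni + nij + nik + nT) * (nk + nik + njk + nT) ≤ Z * (nik + nT))
    (h_fkg_aa12 : (nj + nij + njk + nT) * (nk + nik + njk + nT) ≤ Z * (njk + nT))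
    (h_fkg_AA0 : (nij + nT) * (nik + nT) ≤ Z * nT) (h_fkg_AA1 : (nij + nT) * (njk + nT) ≤ Z * nT)
    (h_fkg_AA2 : (nik + nT) * (njk + nT) ≤ Z * nT) (h_fkg_Aa01 : (nij + nT) * (nk + nik + njk + nT) ≤ Z * nT)
    (h_fkg_Aa02 : (nik + nT) * (nj + nij + njk + nT) ≤ Z * nT)
    (h_fkg_Aa12 : (njk + nT) * (ni + nij + nik + nT) ≤ Z * nT)
    (h_ad_2 : (nij + nik + njk + nT) * nk ≤ (nE + ni + nj + nk) * (nik + njk + nT))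
    (hnA : ((nE + ni + nj + nk) - nk) * (nik + njk) ≤ nk * nij)
    (hN2 : (nE + ni + nj + nk) * nT ≤ Z * (nij + nik + njk))
    (hlamle : (nij + nik + njk + nT) * nk ≤ (Z + (nE + ni + nj + nk)) * (nik + njk)) (hsig : 0 < nik + njk) :
    ∃ rij rik rjk rT : ℝ,
      0 ≤ rij ∧
      0 ≤ rik ∧
      0 ≤ rjk ∧
      0 ≤ rT ∧
      rij ≤ Z * (Z + (nE + ni + nj + nk)) * nij ∧
              rik ≤ Z * (Z + (nE + ni + nj + nk)) * nik ∧
      rjk ≤ Z * (Z + (nE + ni + nj + nk)) * njk ∧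
              rT ≤ Z * (Z + (nE + ni + nj + nk)) * nT ∧
      Z * (nij + nik + njk + nT) * ni ≤
              (Z * (Z + (nE + ni + nj + nk)) * nij - rij) + (Z * (Z + (nE + ni + nj + nk)) * nik - rik) +
              (Z * (Z + (nE + ni + nj + nk)) * nT - rT) ∧
      Z * (nij + nik + njk + nT) * nj ≤
              (Z * (Z + (nE + ni + nj + nk)) * nij - rij) + (Z * (Z + (nE + ni + nj + nk)) * njk - rjk) +
              (Z * (Z + (nE + ni + nj + nk)) * nT - rT) ∧
      Z * (nij + nik + njk + nT) * nk ≤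
              (Z * (Z + (nE + ni + nj + nk)) * nik - rik) + (Z * (Z + (nE + ni + nj + nk)) * njk - rjk) +
              (Z * (Z + (nE + ni + nj + nk)) * nT - rT) ∧
      rij + rik + rjk + rT = Z * Z *
              (nij + nik + njk + nT) ∧
      Z * Z * nT ≤ rT ∧
      Z * Z * (nij + nT) ≤ rij + rT ∧
      Z * Z *
              (nik + nT) ≤ rik + rT ∧
      Z * Z * (njk + nT) ≤ rjk + rT ∧
      Z * Z * (nij + nik + nT) ≤ rij +
              rik + rT ∧
      Z * Z * (nij + njk + nT) ≤ rij + rjk + rT ∧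
      Z * Z * (nik + njk + nT) ≤ rik +
              rjk + rT ∧
      Z * ((nij + nT) * (nik + nT) + (nik + nT) * (nij + nT)) - (nij + nik + njk + nT) *
              (nij + nT) * (nik + nT) ≤ rT ∧
      Z * ((nij + nT) * (njk + nT) + (njk + nT) * (nij + nT)) -
              (nij + nik + njk + nT) * (nij + nT) * (njk + nT) ≤ rT ∧
      Z *
              ((nik + nT) * (njk + nT) + (njk + nT) * (nik + nT)) - (nij + nik + njk + nT) * (nik + nT) *
              (njk + nT) ≤ rT ∧
      Z * ((nij + nT) * (nik + njk + nT) + (nk + nik + njk + nT) * (nij + nT)) -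
              (nij + nik + njk + nT) * (nij + nT) * (nk + nik + njk + nT) ≤ rT ∧
      Z *
              ((nik + nT) * (nij + njk + nT) + (nj + nij + njk + nT) * (nik + nT)) - (nij + nik + njk + nT) *
              (nik + nT) * (nj + nij + njk + nT) ≤ rT ∧
      Z *
              ((njk + nT) * (nij + nik + nT) + (ni + nij + nik + nT) * (njk + nT)) - (nij + nik + njk + nT) *
              (njk + nT) * (ni + nij + nik + nT) ≤ rT ∧
      Z *
              ((ni + nij + nik + nT) * (nij + nik + nT) + (ni + nij + nik + nT) * (nij + nik + nT)) -
              (nij + nik + njk + nT) * (ni + nij + nik + nT) * (ni + nij + nik + nT) ≤ rij + rik + rT ∧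
      Z *
              ((nj + nij + njk + nT) * (nij + njk + nT) + (nj + nij + njk + nT) * (nij + njk + nT)) -
              (nij + nik + njk + nT) * (nj + nij + njk + nT) * (nj + nij + njk + nT) ≤ rij + rjk + rT ∧
      Z *
              ((nk + nik + njk + nT) * (nik + njk + nT) + (nk + nik + njk + nT) * (nik + njk + nT)) -
              (nij + nik + njk + nT) * (nk + nik + njk + nT) * (nk + nik + njk + nT) ≤ rik + rjk + rT ∧
      Z *
              ((ni + nij + nik + nT) * (nij + njk + nT) + (nj + nij + njk + nT) * (nij + nik + nT)) -
              (nij + nik + njk + nT) * (ni + nij + nik + nT) * (nj + nij + njk + nT) ≤ rij + rT ∧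
      Z *
              ((ni + nij + nik + nT) * (nik + njk + nT) + (nk + nik + njk + nT) * (nij + nik + nT)) -
              (nij + nik + njk + nT) * (ni + nij + nik + nT) * (nk + nik + njk + nT) ≤ rik + rT ∧
      Z *
              ((nj + nij + njk + nT) * (nik + njk + nT) + (nk + nik + njk + nT) * (nij + njk + nT)) -
              (nij + nik + njk + nT) * (nj + nij + njk + nT) * (nk + nik + njk + nT) ≤ rjk + rT := by
  obtain ⟨th, hth, hth0, hth1⟩ : ∃ th : ℝ, th * (nik + njk) = (nij + nik + njk + nT) * nk ∧ 0 ≤ th ∧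
      th ≤ Z + (nE + ni + nj + nk) :=
    ⟨(nij + nik + njk + nT) * nk / (nik + njk), div_mul_cancel₀ _ hsig.ne', div_nonneg (by positivity) hsig.le,
      (div_le_iff₀ hsig).2 hlamle⟩
  have hN2pos : 0 < nij + nik + njk := by linarith [hsig, h_nn_01]
  obtain ⟨v1, v2, v3, v4, v5, v6, v7, v8, v9, v10, v11, v12, v13, v14, v15, v16, v17, v18, v19⟩ :=
          cert_Ap_valid nE ni nj nk nij nik njk nT Z h_nn_E h_nn_0 h_nn_1 h_nn_2 h_nn_01 h_nn_02 h_nn_12 h_nn_T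
          h_nn_Z h_ad_2 hnA hN2 hN2pos hsig th hth hth0 hth1
  obtain ⟨w1, w2, w3, w4, w5, w6⟩ :=
    cert_Ap_pairs nE ni nj nk nij nik njk nT Z h_nn_E h_nn_0 h_nn_1 h_nn_2
          h_nn_01 h_nn_02 h_nn_12 h_nn_T h_nn_Z h_sum h_fkg_AA0 h_fkg_AA1 h_fkg_AA2 h_fkg_Aa01 h_fkg_Aa02
          h_fkg_Aa12  
  obtain ⟨x1, x2, x3, x4, x5, x6⟩ :=
    cert_Ap_pairsR nE ni nj nk nij nik njk nT Z h_nn_E h_nn_0 h_nn_1 h_nn_2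
          h_nn_01 h_nn_02 h_nn_12 h_nn_T h_nn_Z h_sum h_lsm_r2 h_fkg_aa02 h_fkg_aa12 h_ad_2 hnA hsig th hth
  exact ⟨(Z*(nij + nik + njk + nT)*(Z + nk) - Z*(Z + (nE + ni + nj + nk))*(nik + njk + nT)),
          (Z*(Z + (nE + ni + nj + nk) - th)*nik), (Z*(Z + (nE + ni + nj + nk) - th)*njk),
          (Z*(Z + (nE + ni + nj + nk))*nT),
    v1, v2, v3, v4, v5, v6, v7, v8, v9, v10, v11, v12, v13, v14, v15,
          v16, v17, v18, v19, w1, w2, w3, w4, w5, w6, x1, x2, x3, x4, x5, x6⟩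

end Summit.CriticalPhenomena.PercolationContinuityZ3.Theorems.SahiE3MajCert
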